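import Literature.Combinatorics.SimpleGraph.CopyHypergraph
import Literature.Combinatorics.SimpleGraph.RamseyMulticolour
import HarnessLib

/-!
# Ramsey supersaturation and Nenadov–Steger's Corollary 3 for the copy hypergraph — proved

Nenadov–Steger (CPC 2016), §2, the "first tool" of the proof of the 1-statement of the random
Ramsey theorem, for a graph `F` on `Fin k` without isolated vertices:

* `ramsey_supersaturation` — **Theorem 2 (folklore)**: with `M` a Ramsey number for `K_k` and
  `r` colours (from `ramseyMulticolour_finset`), every `r`-colouring of the pairs of `Fin n`,
  `n ≥ M`, has at least `C(n,k)/C(M,k)` monochromatic copies of `F` ("every `M`-subset contains a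
  monochromatic copy, and every copy lies in at most `C(n-k, M-k)` `M`-subsets").
* `ns_corollary3` — **Corollary 3** with explicit constants: if `C_0, …, C_{r-1} ⊆ E(K_n)` each
  carry fewer than `ε |H_n(F)|` copies (`ε = 1/(2^{k+2} k! C(M,k) r)`, `M` for `r+1` colours),
  then at least `δ n²` pairs lie outside `⋃ C_j` (`δ = 1/(2^{k+2} k! C(M,k) k^k)`), by colouring
  each pair with the least `j` such that it lies in `C_j` and an extra colour otherwise.

plus the counting facts `card_copyH_le` (`≤ n^k` copies), `pow_div_le_choose`
(`C(n,k) ≥ (n/2)^k/k!` for `n ≥ 2k`), `card_induce_copyH_le` (copies inside a set of pairs `D`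
number `≤ |D| k^k n^{k-2}`). Everything is a theorem; no named facts.

## References

* R. Nenadov, A. Steger, *A short proof of the random Ramsey theorem*, CPC 25 (2016), Thm. 2 and
  Cor. 3 (p. 2). [NenadovSteger2014]
-/

namespace Literature.Combinatorics.SimpleGraph

open Finset Literature.Combinatorics.Hypergraph
open _root_.SimpleGraph

/-! ## Ramsey supersaturation (Nenadov–Steger Thm. 2) and its Corollary 3, for the copy hypergraph -/

section Supersaturation

variable {k : ℕ} {F : _root_.SimpleGraph (Fin k)} [DecidableRel F.Adj]

/-- A copy all of whose pairs join two distinct vertices of a set `t` on which the colouring `c`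
is constant is monochromatic. [folklore] -/
theorem copyMap_mono {n r : ℕ} (c : Sym2 (Fin n) → Fin r) {t : Finset (Fin n)} (i : Fin r)
    (ht : ∀ u ∈ t, ∀ v ∈ t, u ≠ v → c s(u, v) = i) (φ : Fin k ↪ Fin n) (hφ : ∀ a, φ a ∈ t) :
    ∀ x ∈ copyMap F n φ, c x = i := by
  intro x hx
  rw [mem_copyMap] at hx
  obtain ⟨e, he, rfl⟩ := hx
  rw [mem_edgeFinset] at he
  induction e using Sym2.ind with
  | _ a b =>
    rw [Function.Embedding.sym2Map_apply, Sym2.map_mk]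
    exact ht _ (hφ a) _ (hφ b) fun h => (F.ne_of_adj he) (φ.injective h)

/-- The number of copies is at most `n^k` (one per embedding at most). [folklore] -/
theorem card_copyH_le (n : ℕ) : #(copyH F n) ≤ n ^ k := by
  classical
  calc #(copyH F n) ≤ #(univ : Finset (Fin k ↪ Fin n)) := card_image_le
    _ = n.descFactorial k := by
        rw [card_univ, Fintype.card_embedding_eq, Fintype.card_fin, Fintype.card_fin]
    _ ≤ n ^ k := Nat.descFactorial_le_pow n k

/-- **Ramsey supersaturation (Nenadov–Steger, Thm. 2, "folklore"), copy-hypergraph form.** For a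
graph `F` on `Fin k` without isolated vertices and `r` colours there is `M` (a Ramsey number for
`K_k` and `r` colours, `M ≥ k`) such that for every `n ≥ M` and every colouring `c` of the pairs
of `Fin n`, the number `m` of monochromatic copies of `F` satisfies `C(n, k) ≤ C(M, k) · m`
("every `M`-subset contains a monochromatic copy, and every copy lies in at most `C(n-k, M-k)`
`M`-subsets"). [cite: NenadovSteger2014, Thm. 2 (p. 2)] -/
theorem ramsey_supersaturation (hF : ∀ a : Fin k, ∃ b, F.Adj a b) (r : ℕ) :
    ∃ M : ℕ, k ≤ M ∧ ∀ n : ℕ, M ≤ n → ∀ c : Sym2 (Fin n) → Fin r,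
      n.choose k ≤ M.choose k *
        #((copyH F n).filter fun e => ∃ i : Fin r, ∀ x ∈ e, c x = i) := by
  classical
  obtain ⟨M₀, hM₀⟩ := ramseyMulticolour_finset r k
  refine ⟨max M₀ k, le_max_right _ _, fun n hn c => ?_⟩
  set M := max M₀ k with hM
  -- a monochromatic `k`-set inside each `M`-set
  have hmono : ∀ S : Finset (Fin n), #S = M → ∃ t ⊆ S, #t = k ∧ ∃ i : Fin r,
      ∀ u ∈ t, ∀ v ∈ t, u ≠ v → c s(u, v) = i := fun S hS =>
    hM₀ S (by rw [hS]; exact le_max_left _ _) c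
  -- the copy on the monochromatic set
  let g : Finset (Fin n) → Finset (Sym2 (Fin n)) := fun S =>
    if h : ∃ t ⊆ S, #t = k ∧ ∃ i : Fin r, ∀ u ∈ t, ∀ v ∈ t, u ≠ v → c s(u, v) = i then
      copyMap F n ((Classical.choose h).orderEmbOfFin (Classical.choose_spec h).2.1).toEmbedding
    else ∅
  set mono := (copyH F n).filter fun e => ∃ i : Fin r, ∀ x ∈ e, c x = i with hmono_def
  set PM := (univ : Finset (Fin n)).powersetCard M with hPM
  have hg : ∀ S ∈ PM, g S ∈ mono ∧ verts (g S) ⊆ S := by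
    intro S hS
    have hSM : #S = M := (mem_powersetCard.1 hS).2
    have h := hmono S hSM
    have hgS : g S = copyMap F n ((Classical.choose h).orderEmbOfFin
        (Classical.choose_spec h).2.1).toEmbedding := dif_pos h
    obtain ⟨htS, htk, i, hi⟩ := Classical.choose_spec h
    have hmem : ∀ a, ((Classical.choose h).orderEmbOfFin htk).toEmbedding a ∈ Classical.choose h :=
      fun a => (Classical.choose h).orderEmbOfFin_mem htk a
    rw [hgS]
    refine ⟨?_, ?_⟩
    · rw [hmono_def, mem_filter]
      exact ⟨mem_copyH.2 ⟨_, rfl⟩, i, copyMap_mono c i hi _ hmem⟩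
    · rw [verts_copyMap_eq hF]
      intro v hv
      rw [mem_map] at hv
      obtain ⟨a, -, rfl⟩ := hv
      exact htS (hmem a)
  -- fibres of `g` are small: `g S = e` forces `verts e ⊆ S`
  have hfib : ∀ e ∈ PM.image g, #(PM.filter fun S => g S = e) ≤ (n - k).choose (M - k) := by
    intro e he
    rw [mem_image] at he
    obtain ⟨S₀, hS₀, rfl⟩ := he
    have hverts : #(verts (g S₀)) = k := by
      have hSM : #S₀ = M := (mem_powersetCard.1 hS₀).2
      have h := hmono S₀ hSM
      have hgS : g S₀ = copyMap F n ((Classical.choose h).orderEmbOfFin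
          (Classical.choose_spec h).2.1).toEmbedding := dif_pos h
      rw [hgS, verts_copyMap_eq hF, card_map, card_univ, Fintype.card_fin]
    calc #(PM.filter fun S => g S = g S₀)
        ≤ #(PM.filter fun S => verts (g S₀) ⊆ S) := by
          apply card_le_card
          intro S hS
          rw [mem_filter] at hS ⊢
          exact ⟨hS.1, hS.2 ▸ (hg S hS.1).2⟩
      _ ≤ (#(univ : Finset (Fin n)) - #(verts (g S₀))).choose (M - #(verts (g S₀))) :=
          card_filter_powersetCard_superset_le _ _ (subset_univ _) M
      _ = (n - k).choose (M - k) := by rw [card_univ, Fintype.card_fin, hverts]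
  have hcount : #PM ≤ (n - k).choose (M - k) * #(PM.image g) :=
    card_le_mul_card_image PM _ hfib
  have himg : PM.image g ⊆ mono := by
    intro e he
    rw [mem_image] at he
    obtain ⟨S, hS, rfl⟩ := he
    exact (hg S hS).1
  have hPMcard : #PM = n.choose M := by
    rw [hPM, card_powersetCard, card_univ, Fintype.card_fin]
  -- `C(n, M) C(M, k) = C(n, k) C(n-k, M-k)`
  have hkM : k ≤ M := le_max_right _ _
  have hid := Nat.choose_mul (n := n) (k := M) (s := k) hkM
  have hpos : 0 < (n - k).choose (M - k) := Nat.choose_pos (by omega)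
  have h1 : n.choose M * M.choose k ≤ (n - k).choose (M - k) * #mono * M.choose k := by
    have := Nat.mul_le_mul_right (M.choose k) (hcount.trans
      (Nat.mul_le_mul_left _ (card_le_card himg)))
    rwa [hPMcard] at this
  rw [hid] at h1
  have h2 : n.choose k * (n - k).choose (M - k) ≤ (M.choose k * #mono) * (n - k).choose (M - k) := by
    calc n.choose k * (n - k).choose (M - k)
        ≤ (n - k).choose (M - k) * #mono * M.choose k := h1
      _ = (M.choose k * #mono) * (n - k).choose (M - k) := by ring
  exact Nat.le_of_mul_le_mul_right h2 hpos

/-- `C(n, k) ≥ (n/2)^k / k!` for `n ≥ 2k` (from `(n+1-k)^k ≤ n^{(k)} = k! C(n,k)`). [folklore] -/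
theorem pow_div_le_choose {n : ℕ} (hn : 2 * k ≤ n) :
    ((n : ℝ) / 2) ^ k / k.factorial ≤ n.choose k := by
  have hfac : (0 : ℝ) < k.factorial := by exact_mod_cast Nat.factorial_pos k
  rw [div_le_iff₀ hfac]
  have h1 := Nat.pow_sub_le_descFactorial n k
  rw [Nat.descFactorial_eq_factorial_mul_choose] at h1
  have h1R : ((n + 1 - k : ℕ) : ℝ) ^ k ≤ (k.factorial : ℝ) * (n.choose k : ℝ) := by
    exact_mod_cast h1
  have h2 : (n : ℝ) / 2 ≤ ((n + 1 - k : ℕ) : ℝ) := by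
    rw [Nat.cast_sub (by omega)]
    push_cast
    have : (2 * k : ℝ) ≤ n := by exact_mod_cast hn
    linarith
  calc ((n : ℝ) / 2) ^ k ≤ ((n + 1 - k : ℕ) : ℝ) ^ k := pow_le_pow_left₀ (by positivity) h2 k
    _ ≤ (k.factorial : ℝ) * (n.choose k : ℝ) := h1R
    _ = (n.choose k : ℝ) * k.factorial := mul_comm _ _

/-- Edges of the copy hypergraph inside a set `D` of pairs: at most `|D| · k^k · n^{k-2}`
(each edge of `H[D]` meets `D`, and a pair of distinct vertices lies in `≤ k^k n^{k-2}` copies).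
[cite: NenadovSteger2014, Cor. 3 (proof: "every edge is contained in at most 2e_F n^{v_F-2} copies")] -/
theorem card_induce_copyH_le (hE : F.edgeFinset.Nonempty) {n : ℕ} {D : Finset (Sym2 (Fin n))}
    (hD : D ⊆ pairsX n) : #(induce (copyH F n) D) ≤ #D * (k ^ k * n ^ (k - 2)) := by
  classical
  have hmeet : ∀ e ∈ induce (copyH F n) D, (e ∩ D).Nonempty := by
    intro e he
    rw [mem_induce] at he
    rw [inter_eq_left.2 he.2]
    obtain ⟨φ, rfl⟩ := mem_copyH.1 he.1
    rw [← card_pos, card_copyMap]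
    exact card_pos.2 hE
  calc #(induce (copyH F n) D) ≤ ∑ x ∈ D, hdeg (induce (copyH F n) D) {x} :=
        card_le_sum_hdeg_of_meets _ D hmeet
    _ ≤ ∑ x ∈ D, hdeg (copyH F n) {x} := sum_le_sum fun x _ => hdeg_mono (induce_subset _ _) _
    _ ≤ ∑ _x ∈ D, k ^ k * n ^ (k - 2) := by
        refine sum_le_sum fun x hx => ?_
        have hverts : #(verts ({x} : Finset (Sym2 (Fin n)))) = 2 := by
          have hnd : ¬ x.IsDiag := mem_pairsX.1 (hD hx)
          induction x using Sym2.ind with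
          | _ a b =>
            rw [Sym2.mk_isDiag_iff] at hnd
            have : verts ({s(a, b)} : Finset (Sym2 (Fin n))) = {a, b} := by
              ext v
              rw [mem_verts]
              simp only [mem_singleton, exists_eq_left, Sym2.mem_iff, mem_insert]
            rw [this, card_pair hnd]
        have := hdeg_copyH_le (F := F) ({x} : Finset (Sym2 (Fin n)))
        rwa [hverts] at this
    _ = #D * (k ^ k * n ^ (k - 2)) := by rw [sum_const, smul_eq_mul]

/-- **Nenadov–Steger, Corollary 3 (copy-hypergraph form, explicit constants).** Let `F` be a
graph on `Fin k` without isolated vertices and with at least one edge, and `r ≥ 1`. With `M` from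
`ramsey_supersaturation` for `r + 1` colours put `ε = 1/(2^{k+2} k! C(M,k) r)` and
`δ = 1/(2^{k+2} k! C(M,k) k^k)`. Then for `n ≥ max M 2k`, whenever `C_0, …, C_{r-1} ⊆ pairsX n`
each carry fewer than `ε · |H_n(F)|` copies of `F`, the pairs outside `⋃ C_j` number at least
`δ n²`. (Colour a pair by the least `j` with the pair in `C_j`, and by the extra colour `r`
otherwise; the `≥ C(n,k)/C(M,k)` monochromatic copies are mostly of colour `r`, and each pair lies
in `≤ k^k n^{k-2}` copies.) [cite: NenadovSteger2014, Cor. 3 (p. 2)] -/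
theorem ns_corollary3 (hF : ∀ a : Fin k, ∃ b, F.Adj a b) (hE : F.edgeFinset.Nonempty) (r : ℕ)
    (hr : 1 ≤ r) :
    ∃ M : ℕ, k ≤ M ∧ ∀ n : ℕ, max M (2 * k) ≤ n →
      ∀ Cs : Fin r → Finset (Sym2 (Fin n)), (∀ j, Cs j ⊆ pairsX n) →
        (∀ j, (#(induce (copyH F n) (Cs j)) : ℝ) <
          (1 / (2 ^ (k + 2) * k.factorial * M.choose k * r)) * #(copyH F n)) →
        (1 / (2 ^ (k + 2) * k.factorial * M.choose k * (k : ℝ) ^ k)) * (n : ℝ) ^ 2 ≤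
          #(pairsX n \ Finset.univ.biUnion Cs) := by
  classical
  obtain ⟨M, hkM, hM⟩ := ramsey_supersaturation hF (r + 1)
  refine ⟨M, hkM, fun n hn Cs hCs hfew => ?_⟩
  have hMn : M ≤ n := (le_max_left _ _).trans hn
  have h2kn : 2 * k ≤ n := (le_max_right _ _).trans hn
  set D := pairsX n \ Finset.univ.biUnion Cs with hDdef
  -- the colouring
  let c : Sym2 (Fin n) → Fin (r + 1) := fun x =>
    if h : ∃ j, x ∈ Cs j then Fin.castSucc (Classical.choose h) else Fin.last r
  have hc_lt : ∀ x (j : Fin r), c x = Fin.castSucc j → x ∈ Cs j := by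
    intro x j hx
    by_cases h : ∃ j, x ∈ Cs j
    · have : c x = Fin.castSucc (Classical.choose h) := dif_pos h
      rw [this] at hx
      have hj := Fin.castSucc_injective _ hx
      rw [← hj]
      exact Classical.choose_spec h
    · have : c x = Fin.last r := dif_neg h
      rw [this] at hx
      exact absurd hx.symm (Fin.castSucc_lt_last j).ne
  have hc_last : ∀ x, c x = Fin.last r → ∀ j, x ∉ Cs j := by
    intro x hx j hxj
    have h : ∃ j, x ∈ Cs j := ⟨j, hxj⟩
    have : c x = Fin.castSucc (Classical.choose h) := dif_pos h
    rw [this] at hx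
    exact (Fin.castSucc_lt_last _).ne hx
  -- monochromatic copies split by colour
  set mono := (copyH F n).filter fun e => ∃ i : Fin (r + 1), ∀ x ∈ e, c x = i with hmono
  have hsplit : mono ⊆ (Finset.univ.biUnion fun j : Fin r => induce (copyH F n) (Cs j)) ∪
      induce (copyH F n) D := by
    intro e he
    rw [hmono, mem_filter] at he
    obtain ⟨heH, i, hi⟩ := he
    rw [mem_union, mem_biUnion]
    refine Fin.lastCases ?_ (fun j => ?_) i hi
    · intro hi
      right
      rw [mem_induce]
      refine ⟨heH, fun x hx => ?_⟩
      rw [hDdef, mem_sdiff]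
      refine ⟨(mem_powersetCard.1 (copyH_subset_powersetCard n heH)).1 hx, fun hU => ?_⟩
      rw [mem_biUnion] at hU
      obtain ⟨j, -, hxj⟩ := hU
      exact hc_last x (hi x hx) j hxj
    · intro hi
      left
      exact ⟨j, mem_univ _, mem_induce.2 ⟨heH, fun x hx => hc_lt x j (hi x hx)⟩⟩
  -- count
  have hsuper := hM n hMn c
  have hmonoR : (n.choose k : ℝ) ≤ (M.choose k : ℝ) * #mono := by exact_mod_cast hsuper
  have hchoose := pow_div_le_choose (k := k) h2kn
  have hcard_mono : (#mono : ℝ) ≤ ∑ j : Fin r, (#(induce (copyH F n) (Cs j)) : ℝ) +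
      #(induce (copyH F n) D) := by
    calc (#mono : ℝ) ≤ #((Finset.univ.biUnion fun j : Fin r => induce (copyH F n) (Cs j)) ∪
          induce (copyH F n) D) := by exact_mod_cast card_le_card hsplit
      _ ≤ #(Finset.univ.biUnion fun j : Fin r => induce (copyH F n) (Cs j)) +
          #(induce (copyH F n) D) := by exact_mod_cast card_union_le _ _
      _ ≤ _ := by
          gcongr
          exact_mod_cast card_biUnion_le
  have hH : (#(copyH F n) : ℝ) ≤ (n : ℝ) ^ k := by exact_mod_cast card_copyH_le (F := F) n
  have hDcount : (#(induce (copyH F n) D) : ℝ) ≤ #D * ((k : ℝ) ^ k * (n : ℝ) ^ (k - 2)) := by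
    exact_mod_cast card_induce_copyH_le hE (sdiff_subset (s := pairsX n) (t := Finset.univ.biUnion Cs))
  -- constants
  set A : ℝ := 2 ^ (k + 2) * k.factorial * M.choose k with hA
  have hMk : (1 : ℝ) ≤ M.choose k := by exact_mod_cast Nat.choose_pos hkM
  have hApos : 0 < A := by rw [hA]; positivity
  have hfewsum : ∑ j : Fin r, (#(induce (copyH F n) (Cs j)) : ℝ) ≤ (1 / (A * r)) * (n : ℝ) ^ k * r := by
    calc ∑ j : Fin r, (#(induce (copyH F n) (Cs j)) : ℝ)
        ≤ ∑ _j : Fin r, (1 / (A * r)) * (n : ℝ) ^ k := by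
          refine sum_le_sum fun j _ => (hfew j).le.trans ?_
          rw [hA]
          exact mul_le_mul_of_nonneg_left hH (by positivity)
      _ = (1 / (A * r)) * (n : ℝ) ^ k * r := by
          rw [sum_const, card_univ, Fintype.card_fin, nsmul_eq_mul]; ring
  have hrR : (1 : ℝ) ≤ r := by exact_mod_cast hr
  have hfewsum' : ∑ j : Fin r, (#(induce (copyH F n) (Cs j)) : ℝ) ≤ (n : ℝ) ^ k / A := by
    refine hfewsum.trans (le_of_eq ?_)
    field_simp
  -- `C(n,k)/C(M,k) ≥ (n/2)^k/(k! C(M,k)) = 4 n^k / A`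
  have hlow : 4 * (n : ℝ) ^ k / A ≤ #mono := by
    have h1 : ((n : ℝ) / 2) ^ k / k.factorial ≤ (M.choose k : ℝ) * #mono := hchoose.trans hmonoR
    rw [hA]
    have hMpos : (0 : ℝ) < M.choose k := by linarith
    rw [div_le_iff₀ (by positivity)]
    rw [div_le_iff₀ (by exact_mod_cast Nat.factorial_pos k)] at h1
    have : ((n : ℝ) / 2) ^ k = (n : ℝ) ^ k / 2 ^ k := by rw [div_pow]
    rw [this, div_le_iff₀ (by positivity)] at h1
    calc 4 * (n : ℝ) ^ k = (n : ℝ) ^ k * 4 := mul_comm _ _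
      _ ≤ ((M.choose k : ℝ) * #mono * k.factorial * 2 ^ k) * 4 :=
          mul_le_mul_of_nonneg_right h1 (by norm_num)
      _ = #mono * (2 ^ (k + 2) * k.factorial * (M.choose k : ℝ)) := by ring
  -- combine: `#(H[D]) ≥ 3 n^k / A`, hence `|D| ≥ n² /(A k^k)` (using `n ≥ 1` when `k ≥ 1`)
  have hDlow : 3 * (n : ℝ) ^ k / A ≤ #D * ((k : ℝ) ^ k * (n : ℝ) ^ (k - 2)) := by
    have := hcard_mono
    have h4 : 4 * (n : ℝ) ^ k / A - (n : ℝ) ^ k / A ≤ #(induce (copyH F n) D) := by linarith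
    have : 4 * (n : ℝ) ^ k / A - (n : ℝ) ^ k / A = 3 * (n : ℝ) ^ k / A := by ring
    linarith
  -- `k ≥ 1` (F has an edge) and `n ≥ 1`
  have hk1 : 1 ≤ k := by
    obtain ⟨e, he⟩ := hE
    rcases Nat.eq_zero_or_pos k with hk0 | hk0
    · subst hk0
      induction e using Sym2.ind with
      | _ a b => exact a.elim0
    · exact hk0
  rcases Nat.eq_zero_or_pos n with hn0 | hn0
  · subst hn0
    simp
  have hnR : (0 : ℝ) < n := by exact_mod_cast hn0
  have hk2 : (n : ℝ) ^ k = (n : ℝ) ^ (k - 2) * (n : ℝ) ^ 2 ∨ k = 1 := by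
    rcases Nat.lt_or_ge k 2 with hk | hk
    · right; omega
    · left; rw [← pow_add]; congr 1; omega
  rcases hk2 with hk2 | hk1'
  · -- `k ≥ 2`
    rw [hk2] at hDlow
    have hnk : (0 : ℝ) < (n : ℝ) ^ (k - 2) := by positivity
    have hkk : (0 : ℝ) < (k : ℝ) ^ k := by positivity
    rw [div_le_iff₀ (by positivity)] at hDlow
    rw [one_div, inv_mul_le_iff₀ (by positivity)]
    nlinarith
  · -- `k = 1` is impossible for a graph with an edge and no isolated vertices… but `F` on one
    -- vertex has no edge; derive the claim from `hE` directly
    subst hk1'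
    obtain ⟨e, he⟩ := hE
    exfalso
    rw [mem_edgeFinset] at he
    induction e using Sym2.ind with
    | _ a b =>
      have hab := F.ne_of_adj he
      exact hab (Subsingleton.elim a b)

end Supersaturation

end Literature.Combinatorics.SimpleGraph
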